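import Literature.NumberTheory.LFunctions.TypicalOrdinateCounting
import Literature.NumberTheory.LFunctions.MertensContourCalculus
import HarnessLib

/-!
# The dyadic level-set sum of Soundararajan's contour (Balazard–de Roton 2008, Proposition 24)

Topic `Literature/NumberTheory/LFunctions`; a brick of the reduction of
`Literature.NumberTheory.LFunctions.BalazardDeRoton2010_thm1` to the engine statements of
Soundararajan's method. M. Balazard, A. de Roton, arXiv:0810.3587, §8.4, proof of

> **Proposition 24.** `B_N ≪_δ exp((log N)^{1/2}(log log N)^{5−c+6δ})`,

there for the sums `B_N(T) = Σ_{T ≤ n < 2T} (1/n) exp(V_n log(log N/log n) + 2(1+2δ)V_n log log V_n)`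
over one dyadic block: "Nous réarrangeons `B_N(T)` suivant les valeurs de `V_n`" — the values
`V ≤ 2(log log T)² + 1` are counted trivially (`card ≤ T`), the values `V > 2(log log T)² + 1` by
Proposition 20 through the minimality of `V_n` (`TypicalCounting.card_ladder_eq_le`), and the
resulting exponent `AV − V log V + (4+5δ)V log log V` is maximized by Proposition 23
(`MertensContour.linear_sub_xlogx_le`).

We prove this block estimate for the exponent in the form delivered by Proposition 9
(`TypicalPointwise.norm_cpow_mul_inv_zeta_le`): with
`blockExp δ D₂ A' V = V·A' + 2(1+δ)V log log V + D₂Vδ⁻²` (`A' = log(log x/log T) ≥ 0`, `D₂ ≥ 0`),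
`TypicalLevelSets.sum_exp_blockExp_ladder_le` bounds `Σ_{T ≤ n < 2T} exp(blockExp δ D₂ A' V_n)` by
`T·(exp(blockExp δ D₂ A' (2(log log T)²+2)) + 2C(log T/log log T + 1)·exp(2^{4+4δ} e^{A} A^{4+4δ}))`,
`A = A' + log log log T + D + D₂δ⁻²`, for `T` beyond an explicit (astronomical, harmless) threshold;
here `C, D` are the constants of Proposition 20 (`TypicalCounting.Prop20With δ C D T₀`). The
elementary exponent comparison is `blockExp_add_le` (the source's
"`≪ T exp(−V log(V/log log T) + 2V log log V + O(V))`" step, with `4+4δ ≤ 4+5δ`).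

## References

* [BalazardRoton2008] M. Balazard, A. de Roton, arXiv:0810.3587, §8.4 (Prop. 24 and its proof),
  Prop. 23, Prop. 20.
-/

noncomputable section

open Real Finset

namespace Literature.NumberTheory.LFunctions

namespace TypicalLevelSets

open Soundararajan TypicalLadder TypicalCounting

/-- The block exponent `V·A' + 2(1+δ)·V·log log V + D₂·V·δ⁻²` of Balazard–de Roton 2008, Prop. 9 /
§8.3 (`A'` stands for `log(log x/log T)`). [cite: BalazardRoton2008, §8.3] -/
def blockExp (δ D₂ A' V : ℝ) : ℝ :=
  V * A' + 2 * (1 + δ) * V * Real.log (Real.log V) + D₂ * V * δ⁻¹ ^ 2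

/-- `e ≤ log 16` (as `4 log 2 > 2.77 > e`). [folklore] -/
lemma exp_one_le_log_sixteen : Real.exp 1 ≤ Real.log 16 := by
  have e : Real.log 16 = 4 * Real.log 2 := by
    rw [show (16 : ℝ) = 2 ^ 4 by norm_num, Real.log_pow]; norm_num
  rw [e]
  have h1 := Real.log_two_gt_d9
  have h2 := Real.exp_one_lt_d9
  linarith

/-- `log log` is at least `1` and monotone on `[16, ∞)` (`16 > e^e`). [folklore] -/
lemma loglog_facts {V W : ℝ} (hV : 16 ≤ V) (hVW : V ≤ W) :
    1 ≤ Real.log (Real.log V) ∧ Real.log (Real.log V) ≤ Real.log (Real.log W) := by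
  have hlogV : Real.exp 1 ≤ Real.log V :=
    exp_one_le_log_sixteen.trans (Real.log_le_log (by norm_num) hV)
  have h1 : 1 ≤ Real.log (Real.log V) := by
    rw [← Real.log_exp 1]; exact Real.log_le_log (Real.exp_pos 1) hlogV
  exact ⟨h1, Real.log_le_log ((Real.exp_pos 1).trans_le hlogV)
    (Real.log_le_log (by linarith) hVW)⟩

/-- `blockExp` is monotone in `V` on `[16, ∞)` (for `A', D₂ ≥ 0`, `δ > 0`). [folklore] -/
lemma blockExp_mono {δ D₂ A' V W : ℝ} (hδ : 0 < δ) (hD₂ : 0 ≤ D₂) (hA' : 0 ≤ A') (hV : 16 ≤ V)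
    (hVW : V ≤ W) : blockExp δ D₂ A' V ≤ blockExp δ D₂ A' W := by
  obtain ⟨h1, h2⟩ := loglog_facts hV hVW
  unfold blockExp
  have hW0 : 0 ≤ W := by linarith
  have t1 : V * A' ≤ W * A' := mul_le_mul_of_nonneg_right hVW hA'
  have t2 : V * Real.log (Real.log V) ≤ W * Real.log (Real.log W) :=
    mul_le_mul hVW h2 (by linarith) hW0
  have hc : 0 ≤ D₂ * δ⁻¹ ^ 2 := by positivity
  have t3 : D₂ * V * δ⁻¹ ^ 2 ≤ D₂ * W * δ⁻¹ ^ 2 := by nlinarith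
  nlinarith

/-- `−(V−1) log((V−1)/ℓ₂) ≤ −V log V + V log ℓ₂ + log V + 1` for `V ≥ 16`, `ℓ₂ ≥ 1`. [folklore] -/
lemma neg_mul_log_div_le {V ℓ₂ : ℝ} (hV : 16 ≤ V) (hℓ : 1 ≤ ℓ₂) :
    -((V - 1) * Real.log ((V - 1) / ℓ₂)) ≤
      -(V * Real.log V) + V * Real.log ℓ₂ + Real.log V + 1 := by
  have hV0 : 0 < V := by linarith
  have hne : V - 1 ≠ 0 := by
    intro h; linarith
  have hlogℓ : 0 ≤ Real.log ℓ₂ := Real.log_nonneg hℓ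
  rw [Real.log_div hne (by linarith)]
  have hq : Real.log (V / (V - 1)) ≤ V / (V - 1) - 1 :=
    Real.log_le_sub_one_of_pos (div_pos hV0 (by linarith))
  rw [Real.log_div hV0.ne' hne] at hq
  have e : V / (V - 1) - 1 = 1 / (V - 1) := by field_simp; ring
  rw [e] at hq
  have h15 : (0 : ℝ) ≤ V - 1 := by linarith
  have h3 := mul_le_mul_of_nonneg_left hq h15
  rw [mul_one_div_cancel hne] at h3
  -- `h3 : (V − 1)(log V − log(V−1)) ≤ 1`
  linarith

/-- `2(V−1) log log(V−1) ≤ 2V log log V` for `V ≥ 16`. [folklore] -/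
lemma two_mul_loglog_le {V : ℝ} (hV : 16 ≤ V) :
    2 * (V - 1) * Real.log (Real.log (V - 1)) ≤ 2 * V * Real.log (Real.log V) := by
  have hll0 : 0 ≤ Real.log (Real.log (V - 1)) := by
    apply Real.log_nonneg
    rw [Real.le_log_iff_exp_le (by linarith)]
    have := Real.exp_one_lt_d9; linarith
  have hmono : Real.log (Real.log (V - 1)) ≤ Real.log (Real.log V) :=
    Real.log_le_log (Real.log_pos (by linarith)) (Real.log_le_log (by linarith) (by linarith))
  have h15 : (0 : ℝ) ≤ V - 1 := by linarith
  have h1 := mul_le_mul_of_nonneg_left hmono h15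
  have hLL0 : 0 ≤ Real.log (Real.log V) := hll0.trans hmono
  nlinarith

/-- `log V + 1 + |D| ≤ 2δ V log log V` once `V ≥ 16`, `V ≥ 4/δ²` and `V ≥ (2+|D|)/δ`. [folklore] -/
lemma log_add_le_mul_loglog {δ D V : ℝ} (hδ0 : 0 < δ) (hV : 16 ≤ V) (hδV : 4 / δ ^ 2 ≤ V)
    (hDV : (2 + |D|) / δ ≤ V) : Real.log V + 1 + |D| ≤ 2 * δ * V * Real.log (Real.log V) := by
  have hV0 : 0 < V := by linarith
  obtain ⟨hLLV1, -⟩ := loglog_facts hV le_rfl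
  have hlog : Real.log V ≤ δ * V := by
    have h1 := MertensContour.log_le_two_mul_sqrt hV0
    have hs : 2 ≤ δ * Real.sqrt V := by
      have h4 : Real.sqrt (4 / δ ^ 2) ≤ Real.sqrt V := Real.sqrt_le_sqrt hδV
      have e : Real.sqrt (4 / δ ^ 2) = 2 / δ := by
        rw [Real.sqrt_div' _ (sq_nonneg δ), Real.sqrt_sq hδ0.le,
          show (4 : ℝ) = 2 ^ 2 by norm_num, Real.sqrt_sq (by norm_num)]
      rw [e, div_le_iff₀ hδ0] at h4
      linarith
    have hsq : Real.sqrt V * Real.sqrt V = V := Real.mul_self_sqrt hV0.le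
    have h2 := mul_le_mul_of_nonneg_right hs (Real.sqrt_nonneg V)
    have e2 : δ * Real.sqrt V * Real.sqrt V = δ * V := by rw [mul_assoc, hsq]
    rw [e2] at h2
    linarith
  have h2 : 1 + |D| ≤ δ * V := by
    rw [div_le_iff₀ hδ0] at hDV; linarith
  have h3 : δ * V ≤ δ * V * Real.log (Real.log V) :=
    le_mul_of_one_le_right (by positivity) hLLV1
  linarith

/-- **The exponent comparison** (Balazard–de Roton 2008, §8.4): for `V ≥ ℓ₂²` (`ℓ₂ = log log T`)
with `ℓ₂` large (explicitly: `ℓ₂ ≥ 4`, `ℓ₂² ≥ 4/δ² + (2+|D|)/δ`, `ℓ₂ ≥ exp(16384 + |D|)`),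
`blockExp δ D₂ A' V − (V−1) log((V−1)/ℓ₂) + 2(V−1) log log(V−1) + D(V−1) ≤ 2^{4+4δ} e^{A} A^{4+4δ}`
with `A = A' + log ℓ₂ + D + D₂δ⁻²` (via `A V − V log V + (4+4δ)V log log V` and Prop. 23).
[cite: BalazardRoton2008, §8.4] -/
lemma blockExp_add_le {δ D D₂ A' ℓ₂ V : ℝ} (hδ0 : 0 < δ) (hδ1 : δ ≤ 1) (hD₂ : 0 ≤ D₂) (hA' : 0 ≤ A')
    (hℓ4 : 4 ≤ ℓ₂) (hℓδ : 4 / δ ^ 2 + (2 + |D|) / δ ≤ ℓ₂ ^ 2) (hℓA : Real.exp (16384 + |D|) ≤ ℓ₂)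
    (hV : ℓ₂ ^ 2 ≤ V) :
    blockExp δ D₂ A' V + (-((V - 1) * Real.log ((V - 1) / ℓ₂)) +
        2 * (V - 1) * Real.log (Real.log (V - 1)) + D * (V - 1)) ≤
      (2 : ℝ) ^ (4 + 4 * δ) * Real.exp (A' + Real.log ℓ₂ + D + D₂ * δ⁻¹ ^ 2) *
        (A' + Real.log ℓ₂ + D + D₂ * δ⁻¹ ^ 2) ^ (4 + 4 * δ) := by
  have hℓ16 : 16 ≤ ℓ₂ ^ 2 := by nlinarith
  have hV16 : 16 ≤ V := hℓ16.trans hV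
  have h0' : 0 ≤ (2 + |D|) / δ := by positivity
  have h0'' : 0 ≤ 4 / δ ^ 2 := by positivity
  have s1 := neg_mul_log_div_le hV16 (show (1 : ℝ) ≤ ℓ₂ by linarith)
  have s2 := two_mul_loglog_le hV16
  have s3 : D * (V - 1) ≤ D * V + |D| := by linarith [neg_abs_le D]
  have s4 := log_add_le_mul_loglog (D := D) hδ0 hV16 (by linarith) (by linarith)
  -- the cleaned exponent `A V − V log V + (4+4δ) V log log V`
  have hsum : blockExp δ D₂ A' V + (-((V - 1) * Real.log ((V - 1) / ℓ₂)) +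
      2 * (V - 1) * Real.log (Real.log (V - 1)) + D * (V - 1)) ≤
      (A' + Real.log ℓ₂ + D + D₂ * δ⁻¹ ^ 2) * V - V * Real.log V +
        (4 + 4 * δ) * V * Real.log (Real.log V) := by
    unfold blockExp
    linarith
  refine hsum.trans ?_
  -- Prop. 23
  have hC1 : (1 : ℝ) ≤ 4 + 4 * δ := by linarith
  have hlogℓ' : 16384 + |D| ≤ Real.log ℓ₂ := by
    rw [← Real.log_exp (16384 + |D|)]
    exact Real.log_le_log (Real.exp_pos _) hℓA
  have hA32 : 32 * (4 + 4 * δ) ^ 3 ≤ A' + Real.log ℓ₂ + D + D₂ * δ⁻¹ ^ 2 := by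
    have h8 : (4 + 4 * δ) ^ 3 ≤ 8 ^ 3 := pow_le_pow_left₀ (by positivity) (by linarith) 3
    have : 0 ≤ D₂ * δ⁻¹ ^ 2 := by positivity
    linarith [neg_abs_le D, abs_nonneg D]
  have hVexp : Real.exp (4 + 4 * δ) < V := by
    have h2 : ℓ₂ ≤ ℓ₂ ^ 2 := by nlinarith
    have h4 : Real.exp (4 + 4 * δ) < ℓ₂ := by
      have : (4 : ℝ) + 4 * δ < 16384 + |D| := by linarith [abs_nonneg D]
      exact (Real.exp_lt_exp.2 this).trans_le hℓA
    linarith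
  exact MertensContour.linear_sub_xlogx_le hC1 hA32 hVexp

variable {δ C D T₀ D₂ A' : ℝ} {T : ℕ}

/-- **Balazard–de Roton 2008, §8.4: the block sum.** Under the conclusion of Proposition 20
(`h20`, with `C ≥ 0`), for a natural number `T ≥ T₀` such that every `[n, n+1] ⊆ [T, 2T]` has an
admissible integer, `A', D₂ ≥ 0`, `0 < δ ≤ 1`, and `ℓ₂ = log log T` beyond the explicit threshold of
`blockExp_add_le`:
`Σ_{T ≤ n < 2T} exp(blockExp δ D₂ A' V_n) ≤ T·(exp(blockExp δ D₂ A' (2ℓ₂²+2)) + 2C(log T/ℓ₂ + 1)·exp(2^{4+4δ} e^{A} A^{4+4δ}))`,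
`A = A' + log ℓ₂ + D + D₂δ⁻²`. [cite: BalazardRoton2008, §8.4 (proof of Prop. 24)] -/
theorem sum_exp_blockExp_ladder_le (h20 : Prop20With δ C D T₀) (hC : 0 ≤ C) (hδ0 : 0 < δ)
    (hδ1 : δ ≤ 1) (hD₂ : 0 ≤ D₂) (hA' : 0 ≤ A') (hT : T₀ ≤ (T : ℝ))
    (hex : ∀ n ∈ Finset.Ico T (2 * T), ∃ W : ℕ, Admissible δ T n W)
    (hℓ4 : 4 ≤ Real.log (Real.log (T : ℝ)))
    (hℓδ : 4 / δ ^ 2 + (2 + |D|) / δ ≤ Real.log (Real.log (T : ℝ)) ^ 2)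
    (hℓA : Real.exp (16384 + |D|) ≤ Real.log (Real.log (T : ℝ))) :
    ∑ n ∈ Finset.Ico T (2 * T), Real.exp (blockExp δ D₂ A' (ladder δ (T : ℝ) n)) ≤
      (T : ℝ) * (Real.exp (blockExp δ D₂ A' (2 * Real.log (Real.log (T : ℝ)) ^ 2 + 2)) +
        2 * C * (Real.log (T : ℝ) / Real.log (Real.log (T : ℝ)) + 1) *
          Real.exp ((2 : ℝ) ^ (4 + 4 * δ) *
            Real.exp (A' + Real.log (Real.log (Real.log (T : ℝ))) + D + D₂ * δ⁻¹ ^ 2) *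
            (A' + Real.log (Real.log (Real.log (T : ℝ))) + D + D₂ * δ⁻¹ ^ 2) ^ (4 + 4 * δ))) := by
  classical
  set ℓ₂ : ℝ := Real.log (Real.log (T : ℝ)) with hℓ₂
  set Φ : ℝ := (2 : ℝ) ^ (4 + 4 * δ) * Real.exp (A' + Real.log ℓ₂ + D + D₂ * δ⁻¹ ^ 2) *
    (A' + Real.log ℓ₂ + D + D₂ * δ⁻¹ ^ 2) ^ (4 + 4 * δ) with hΦ
  set S := Finset.Ico T (2 * T) with hS
  have hℓ0 : 0 < ℓ₂ := by linarith
  have hℓ16 : 16 ≤ ℓ₂ ^ 2 := by nlinarith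
  have hT0 : (0 : ℝ) ≤ T := Nat.cast_nonneg T
  have hlogT : 0 ≤ Real.log (T : ℝ) := Real.log_natCast_nonneg T
  have hcardS : S.card = T := by rw [hS, Nat.card_Ico]; omega
  -- admissibility of every `V_n`
  have hVn : ∀ n ∈ S, ℓ₂ ^ 2 ≤ (ladder δ (T : ℝ) n : ℝ) ∧ (ladder δ (T : ℝ) n : ℝ) ≤ Real.log (T : ℝ) / ℓ₂ := fun n hn ↦
    ⟨(admissible_ladder (hex n hn)).1, (admissible_ladder (hex n hn)).2.1⟩
  -- the threshold `V₁`
  set V₁ : ℕ := ⌊2 * ℓ₂ ^ 2⌋₊ + 2 with hV₁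
  have hV₁lo : 2 * ℓ₂ ^ 2 + 1 < V₁ := by
    rw [hV₁]; push_cast; linarith [Nat.lt_floor_add_one (2 * ℓ₂ ^ 2)]
  have hV₁hi : (V₁ : ℝ) ≤ 2 * ℓ₂ ^ 2 + 2 := by
    rw [hV₁]; push_cast; linarith [Nat.floor_le (show 0 ≤ 2 * ℓ₂ ^ 2 by positivity)]
  rw [← Finset.sum_filter_add_sum_filter_not S (fun n ↦ ladder δ (T : ℝ) n < V₁)]
  -- low values: trivial count
  have hlow : ∑ n ∈ S.filter (fun n ↦ ladder δ (T : ℝ) n < V₁), Real.exp (blockExp δ D₂ A' (ladder δ (T : ℝ) n)) ≤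
      (T : ℝ) * Real.exp (blockExp δ D₂ A' (2 * ℓ₂ ^ 2 + 2)) := by
    have hterm : ∀ n ∈ S.filter (fun n ↦ ladder δ (T : ℝ) n < V₁),
        Real.exp (blockExp δ D₂ A' (ladder δ (T : ℝ) n)) ≤ Real.exp (blockExp δ D₂ A' (2 * ℓ₂ ^ 2 + 2)) := by
      intro n hn
      rw [Finset.mem_filter] at hn
      refine Real.exp_le_exp.2 (blockExp_mono hδ0 hD₂ hA' (hℓ16.trans (hVn n hn.1).1) ?_)
      have : ladder δ (T : ℝ) n + 1 ≤ V₁ := hn.2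
      have : (ladder δ (T : ℝ) n : ℝ) + 1 ≤ V₁ := by exact_mod_cast this
      linarith
    refine (Finset.sum_le_sum hterm).trans ?_
    rw [Finset.sum_const, nsmul_eq_mul]
    refine mul_le_mul_of_nonneg_right ?_ (Real.exp_pos _).le
    have := Finset.card_filter_le S (fun n ↦ ladder δ (T : ℝ) n < V₁)
    rw [hcardS] at this
    exact_mod_cast this
  -- high values: Proposition 20 on each level set
  have hhigh : ∑ n ∈ S.filter (fun n ↦ ¬ladder δ (T : ℝ) n < V₁), Real.exp (blockExp δ D₂ A' (ladder δ (T : ℝ) n)) ≤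
      (T : ℝ) * (2 * C * (Real.log (T : ℝ) / ℓ₂ + 1) * Real.exp Φ) := by
    set S' := S.filter (fun n ↦ ¬ladder δ (T : ℝ) n < V₁) with hS'
    rw [Finset.sum_comp (fun V : ℕ ↦ Real.exp (blockExp δ D₂ A' V)) (ladder δ (T : ℝ))]
    -- each fibre
    have hfib : ∀ V ∈ S'.image (ladder δ (T : ℝ)),
        ((S'.filter fun n ↦ ladder δ (T : ℝ) n = V).card : ℕ) • Real.exp (blockExp δ D₂ A' (V : ℝ)) ≤
          2 * C * T * Real.exp Φ := by
      intro V hV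
      rw [Finset.mem_image] at hV
      obtain ⟨n₀, hn₀, hn₀V⟩ := hV
      rw [hS', Finset.mem_filter] at hn₀
      have hVlo : (V₁ : ℝ) ≤ V := by
        have : V₁ ≤ V := by rw [← hn₀V]; exact not_lt.1 hn₀.2
        exact_mod_cast this
      have hVℓ : ℓ₂ ^ 2 ≤ (V : ℝ) := by rw [← hn₀V]; exact (hVn n₀ hn₀.1).1
      have hV2 : 2 * ℓ₂ ^ 2 + 1 ≤ (V : ℝ) := by linarith
      have hV1 : 1 ≤ V := by
        have : (1 : ℝ) ≤ V := by linarith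
        exact_mod_cast this
      have hVm1 : ((V - 1 : ℕ) : ℝ) = (V : ℝ) - 1 := by rw [Nat.cast_sub hV1, Nat.cast_one]
      -- the count
      have hsub : (S'.filter fun n ↦ ladder δ (T : ℝ) n = V) ⊆ (S.filter fun n ↦ ladder δ (T : ℝ) n = V) := by
        intro n hn
        rw [Finset.mem_filter] at hn ⊢
        rw [hS', Finset.mem_filter] at hn
        exact ⟨hn.1.1, hn.2⟩
      have hcard := card_ladder_eq_le (δ := δ) (T := T) (V := V) h20 hC hT hV2 hex
      rw [hVm1] at hcard
      have hcard' : (((S'.filter fun n ↦ ladder δ (T : ℝ) n = V).card : ℕ) : ℝ) ≤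
          2 * C * T * Real.exp (-(((V : ℝ) - 1) * Real.log (((V : ℝ) - 1) / ℓ₂)) +
            2 * ((V : ℝ) - 1) * Real.log (Real.log ((V : ℝ) - 1)) + D * ((V : ℝ) - 1)) :=
        le_trans (by exact_mod_cast Finset.card_le_card hsub) hcard
      -- the exponent
      have hexp := blockExp_add_le (D := D) hδ0 hδ1 hD₂ hA' hℓ4 hℓδ hℓA hVℓ
      rw [nsmul_eq_mul]
      have h2CT : 0 ≤ 2 * C * (T : ℝ) := by positivity
      calc (((S'.filter fun n ↦ ladder δ (T : ℝ) n = V).card : ℕ) : ℝ) * Real.exp (blockExp δ D₂ A' (V : ℝ))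
          ≤ 2 * C * T * Real.exp (-(((V : ℝ) - 1) * Real.log (((V : ℝ) - 1) / ℓ₂)) +
              2 * ((V : ℝ) - 1) * Real.log (Real.log ((V : ℝ) - 1)) + D * ((V : ℝ) - 1)) *
              Real.exp (blockExp δ D₂ A' (V : ℝ)) :=
            mul_le_mul_of_nonneg_right hcard' (Real.exp_pos _).le
        _ = 2 * C * T * Real.exp (blockExp δ D₂ A' (V : ℝ) +
              (-(((V : ℝ) - 1) * Real.log (((V : ℝ) - 1) / ℓ₂)) +
              2 * ((V : ℝ) - 1) * Real.log (Real.log ((V : ℝ) - 1)) + D * ((V : ℝ) - 1))) := by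
            rw [mul_assoc, ← Real.exp_add, add_comm]
        _ ≤ 2 * C * T * Real.exp Φ := by
            refine mul_le_mul_of_nonneg_left (Real.exp_le_exp.2 ?_) h2CT
            rw [hΦ]; exact hexp
    refine (Finset.sum_le_sum hfib).trans ?_
    rw [Finset.sum_const, nsmul_eq_mul]
    -- number of values
    have himg : ((S'.image (ladder δ (T : ℝ))).card : ℝ) ≤ Real.log (T : ℝ) / ℓ₂ + 1 := by
      have hsub : S'.image (ladder δ (T : ℝ)) ⊆ Finset.range (⌊Real.log (T : ℝ) / ℓ₂⌋₊ + 1) := by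
        intro V hV
        rw [Finset.mem_image] at hV
        obtain ⟨n, hn, rfl⟩ := hV
        rw [hS', Finset.mem_filter] at hn
        rw [Finset.mem_range, Nat.lt_add_one_iff, Nat.le_floor_iff (by positivity)]
        exact (hVn n hn.1).2
      have h1 := Finset.card_le_card hsub
      rw [Finset.card_range] at h1
      have h2 : ((S'.image (ladder δ (T : ℝ))).card : ℝ) ≤ ⌊Real.log (T : ℝ) / ℓ₂⌋₊ + 1 := by exact_mod_cast h1
      exact h2.trans (by linarith [Nat.floor_le (show 0 ≤ Real.log (T : ℝ) / ℓ₂ by positivity)])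
    have h0 : 0 ≤ 2 * C * (T : ℝ) * Real.exp Φ := by positivity
    calc ((S'.image (ladder δ (T : ℝ))).card : ℝ) * (2 * C * T * Real.exp Φ)
        ≤ (Real.log (T : ℝ) / ℓ₂ + 1) * (2 * C * T * Real.exp Φ) :=
          mul_le_mul_of_nonneg_right himg h0
      _ = (T : ℝ) * (2 * C * (Real.log (T : ℝ) / ℓ₂ + 1) * Real.exp Φ) := by ring
  have := add_le_add hlow hhigh
  simpa [mul_add] using this

end TypicalLevelSets

end Literature.NumberTheory.LFunctions

end
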